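import Literature.AlgebraicGeometry.Frobenioids.ArchimedeanFSMFFPiecesA
import HarnessLib

/-!
# Frobenioids II, Proposition 3.4 (viii), condition (a) for `F = N`: the MODEL LEMMAS of the
# non-rigidified angloid `N = N₀ ×_{D₀} D` consumed by the abstract assembly
# (abc-iut cell, layer L1, sub-node `FrdII:Prop3.4(viii)/P34-L14`, pieces M1–M5 for the tower `towerN`)

Mochizuki, *The geometry of Frobenioids II: poly-Frobenioids*, Kyushu J. Math. **62** (2008)
401–460, §3, Proposition 3.4 (viii), proof p. 33 ll. 16–44 [cite: MochizukiFrdII2008, Prop 3.4 (viii) p.33].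

PROOF-ONLY file (nothing is defined): the `N`-analogues of `ArchimedeanFSMFFPiecesA.lean` (same seat),
for the tower `towerN π` (`F = N π`, the wide subcategory of `A π` on the LINEAR isometries;
`F₀ = N₀`), with the class `P α := "the C₀-component of α is a pull-back morphism of C₀"`
(`PreFrobenioid.IsPullbackMorphism C0.toElem α.hom.hom.fst`). Where possible the `N`-statement is
reduced to the `A`-statement through the faithful inclusion `N ⊆ A` (monomorphisms are reflected; an
isomorphism of `A` between objects of `N` whose arrow is linear lies in `N`, cf. t6/w4-d092's
`N.isIso_of_isIso_proj`); the constructions (LiftF₀), (Fac), (LiftD) are those for `A` with the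
linearity of the constructed arrows recorded (`deg_Fr` is multiplicative; the constructed second
members have `deg_Fr = 1`). `N0.isPullbackMorphism_of_hom`: a linear isometry of `C₀` that is a
pull-back morphism of `C₀` is a pull-back morphism of `N₀` (for `N₀ → C₀ → F_{Φ₀}`).
No side is taken on [IUTchIII] Cor. 3.12.
-/

namespace Literature.AlgebraicGeometry.Frobenioids

open CategoryTheory Set
open scoped Pointwise

noncomputable section

namespace ArchFrd

universe v u

/-! ### `N₀`: pull-back morphisms -/

namespace N0

/-- An arrow of `N₀` whose underlying arrow of `C₀` is a pull-back morphism of `C₀` is a pull-back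
morphism of `N₀` (for `N₀ → C₀ → F_{Φ₀}`): cartesian lifts of linear isometries along a linear
isometric pull-back morphism are linear isometries. [cite: MochizukiFrdII2008, Ex 3.3 (iii) p.29] -/
theorem isPullbackMorphism_of_hom {U V : N0} (α : U ⟶ V)
    (hα : PreFrobenioid.IsPullbackMorphism C0.toElem (homCarrier α)) :
    PreFrobenioid.IsPullbackMorphism (N0.toC0 ⋙ C0.toElem) α := by
  intro W
  have hd : C0.degFr (homCarrier α) = 1 := ((C0.isPullbackMorphism_iff _).1 hα).1
  have hα1 : C0.div (homCarrier α) = 1 := α.hom.property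
  constructor
  · intro γ γ' hγ
    apply N0.hom_ext
    apply (hα W.carrier).1
    apply Subtype.ext
    have h1 := congrArg (fun p : PreFrobenioid.PullbackHomData (N0.toC0 ⋙ C0.toElem) α W => p.1.1) hγ
    have h2 := congrArg (fun p : PreFrobenioid.PullbackHomData (N0.toC0 ⋙ C0.toElem) α W => p.1.2) hγ
    exact Prod.ext (congrArg (fun k : W ⟶ V => homCarrier k) h1) h2
  · rintro ⟨⟨γ', g⟩, hw⟩
    obtain ⟨γc, hγc⟩ := (hα W.carrier).2 ⟨(homCarrier γ', g), hw⟩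
    have h1 : γc ≫ homCarrier α = homCarrier γ' :=
      congrArg (fun p : PreFrobenioid.PullbackHomData C0.toElem (homCarrier α) W.carrier => p.1.1) hγc
    have h2 : C0.Base γc = g :=
      congrArg (fun p : PreFrobenioid.PullbackHomData C0.toElem (homCarrier α) W.carrier => p.1.2) hγc
    have hγiso : PreFrobenioid.IsIsometry C0.toElem γc := by
      have hγ' : C0.div (homCarrier γ') = 1 := γ'.hom.property
      change C0.div γc = 1
      have := C0.div_comp γc (homCarrier α)
      rw [h1, hγ', hα1, one_mul, hd, PNat.one_coe, pow_one] at this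
      exact this.symm
    have hγlin : C0.degFr γc = 1 := by
      have hγ' : C0.degFr (homCarrier γ') = 1 := γ'.property
      have := C0.degFr_comp' γc (homCarrier α)
      rw [h1, hγ', hd, mul_one] at this
      exact this.symm
    refine ⟨homMk γc hγiso hγlin, Subtype.ext (Prod.ext ?_ h2)⟩
    exact N0.hom_ext h1

end N0

/-! ### The tower `towerN`: formal pieces -/

variable {D : Type u} [Category.{v} D] (π : D ⥤ D0)

/-- The projection of `towerN` to `D` on arrows: the `D`-component. [cite: MochizukiFrdII2008, Prop 3.4 p.29] -/
theorem N.towerN_toD_map {X Y : (towerN π).F} (f : X ⟶ Y) : (towerN π).toD.map f = f.hom.hom.snd := rfl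

/-- Components of composites in `N` (`D`-components). [cite: MochizukiFrdII2008, Ex 3.3 (iii) p.29] -/
theorem N.comp_hom_hom_snd {X Y Z : (towerN π).F} (g : X ⟶ Y) (f : Y ⟶ Z) :
    (g ≫ f).hom.hom.snd = g.hom.hom.snd ≫ f.hom.hom.snd := rfl

/-- Components of composites in `N` (`C₀`-components). [cite: MochizukiFrdII2008, Ex 3.3 (iii) p.29] -/
theorem N.comp_hom_hom_fst {X Y Z : (towerN π).F} (g : X ⟶ Y) (f : Y ⟶ Z) :
    (g ≫ f).hom.hom.fst = g.hom.hom.fst ≫ f.hom.hom.fst := rfl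

/-- The inclusion `N ⊆ A` reflects monomorphisms. [cite: MochizukiFrdII2008, Ex 3.3 (iii) p.29] -/
theorem N.mono_of_mono_hom {X Y : (towerN π).F} (f : X ⟶ Y) (h : Mono (show
    ((⟨X.obj.obj⟩ : (towerA π).F) ⟶ (⟨Y.obj.obj⟩ : (towerA π).F)) from f.hom)) : Mono f :=
  ⟨fun _ _ hgk => WideSubcategory.hom_ext _ ((@cancel_mono _ _ _ _ _ f.hom h _ _).mp
    (congrArg (fun e => InducedWideCategory.Hom.hom e) hgk))⟩

/-- An isomorphism of `A` between objects of `N` whose arrow is linear is an isomorphism of `N` (the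
inverse of a linear isomorphism is linear). [cite: MochizukiFrdII2008, Ex 3.3 (iii) p.29] -/
theorem N.isIso_of_isIso_aHom {X Y : (towerN π).F} (f : X ⟶ Y) (h : IsIso (show
    ((⟨X.obj.obj⟩ : (towerA π).F) ⟶ (⟨Y.obj.obj⟩ : (towerA π).F)) from f.hom)) : IsIso f := by
  haveI : IsIso f.hom := h
  have hlin : C0.degFr f.hom.hom.fst = 1 := f.property
  have hinv : PreFrobenioid.linearMorphisms (A.toElem π) (inv f.hom) := by
    change C0.degFr (inv f.hom).hom.fst = 1
    have e := congrArg (fun g : X.obj ⟶ X.obj => C0.degFr g.hom.fst) (IsIso.hom_inv_id f.hom)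
    change C0.degFr f.hom.hom.fst * C0.degFr (inv f.hom).hom.fst = 1 at e
    rwa [hlin, one_mul] at e
  exact ⟨⟨⟨inv f.hom, hinv⟩, WideSubcategory.hom_ext _ (IsIso.hom_inv_id f.hom),
    WideSubcategory.hom_ext _ (IsIso.inv_hom_id f.hom)⟩⟩

/-- (Mono) for `N`: an arrow over an isomorphism of `D` whose projection to `N₀` is a monomorphism is
a monomorphism. [cite: MochizukiFrdII2008, Prop 3.4 (viii) p.33] -/
theorem N.mono_of_isIso_snd_of_mono_toN0 {X Y : (towerN π).F} (f : X ⟶ Y)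
    (hD : IsIso ((towerN π).toD.map f)) (h0 : Mono ((towerN π).toF0.map f)) : Mono f := by
  refine ⟨fun g h hgh => WideSubcategory.hom_ext _ (WideSubcategory.hom_ext _ (CFP.hom_ext ?_ ?_))⟩
  · have e : (towerN π).toF0.map g ≫ (towerN π).toF0.map f =
        (towerN π).toF0.map h ≫ (towerN π).toF0.map f := by
      rw [← Functor.map_comp, ← Functor.map_comp, hgh]
    have e' := (cancel_mono _).mp e
    exact congrArg (fun k => N0.homCarrier k) e'
  · haveI : IsIso f.hom.hom.snd := hD
    have e : g.hom.hom.snd ≫ f.hom.hom.snd = h.hom.hom.snd ≫ f.hom.hom.snd := by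
      rw [← N.comp_hom_hom_snd, ← N.comp_hom_hom_snd, hgh]
    exact (cancel_mono _).mp e

/-- (PMono) for `N`: an arrow whose `C₀`-component is a pull-back morphism of `C₀` and whose
`D`-component is a monomorphism is a monomorphism (reduced to `A`).
[cite: MochizukiFrdII2008, Prop 3.4 (viii) p.33] -/
theorem N.mono_of_isPullbackMorphism_fst {Z Y : (towerN π).F} (α : Z ⟶ Y)
    (hP : PreFrobenioid.IsPullbackMorphism C0.toElem α.hom.hom.fst)
    (hD : Mono ((towerN π).toD.map α)) : Mono α :=
  N.mono_of_mono_hom π α (A.mono_of_isPullbackMorphism_fst π (Z := ⟨Z.obj.obj⟩) (Y := ⟨Y.obj.obj⟩)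
    α.hom hP hD)

/-- (PIso) for `N`: an arrow whose `C₀`-component is a pull-back morphism of `C₀` and whose
`D`-component is an isomorphism is an isomorphism (reduced to `A`).
[cite: MochizukiFrdII2008, Prop 3.4 (viii) p.33] -/
theorem N.isIso_of_isPullbackMorphism_fst_of_isIso_snd {Z Y : (towerN π).F} (α : Z ⟶ Y)
    (hP : PreFrobenioid.IsPullbackMorphism C0.toElem α.hom.hom.fst)
    (hD : IsIso ((towerN π).toD.map α)) : IsIso α :=
  N.isIso_of_isIso_aHom π α (A.isIso_of_isPullbackMorphism_fst_of_isIso_snd π (Z := ⟨Z.obj.obj⟩)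
    (Y := ⟨Y.obj.obj⟩) α.hom hP hD)

/-- (vii) for `N` in the shape of the assembly: from the typed item (vii) of `towerN`.
[cite: MochizukiFrdII2008, Prop 3.4 (vii) p.30] -/
theorem N.isFSMI_of_isPullbackMorphism_fst_of_propVII (hVII : (towerN π).PropVII)
    {Z Y : (towerN π).F} (α : Z ⟶ Y) (hP : PreFrobenioid.IsPullbackMorphism C0.toElem α.hom.hom.fst)
    (hD : IsFSMI ((towerN π).toD.map α)) : IsFSMI α :=
  (hVII α (N0.isPullbackMorphism_of_hom ((towerN π).toF0.map α) hP)).2 hD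

/-! ### The tower `towerN`: (LiftF₀) -/

/-- (LiftF₀) for `N`: a factorisation `ε ≫ χ` in `N₀` of the `N₀`-projection of an arrow `β` of `N`,
with `ε` over an isomorphism of `D₀`, lifts to `β = β₁ ≫ β₂` in `N` with `β₁ = (ε, 𝟙)`.
[cite: MochizukiFrdII2008, Prop 3.4 (viii) p.33] -/
theorem N.exists_lift_toN0_fac {X Z : (towerN π).F} (β : X ⟶ Z)
    {W₀ : (towerN π).F0} (ε : (towerN π).toF0.obj X ⟶ W₀) (χ : W₀ ⟶ (towerN π).toF0.obj Z)
    (hfac : ε ≫ χ = (towerN π).toF0.map β)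
    (hε : PreFrobenioid.IsBaseIso C0.toElem (N0.homCarrier ε)) :
    ∃ (W : (towerN π).F) (β₁ : X ⟶ W) (β₂ : W ⟶ Z) (i : (towerN π).toF0.obj W ≅ W₀),
      β₁ ≫ β₂ = β ∧ IsIso ((towerN π).toD.map β₁) ∧ (towerN π).toF0.map β₁ ≫ i.hom = ε ∧
        i.inv ≫ (towerN π).toF0.map β₂ = χ := by
  obtain ⟨⟨⟨X0, XD, ιX⟩⟩⟩ := X
  obtain ⟨⟨⟨Z0, ZD, ιZ⟩⟩⟩ := Z
  obtain ⟨⟨⟨f0, fD, w⟩, hf⟩, hfl⟩ := β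
  obtain ⟨⟨W0⟩⟩ := W₀
  obtain ⟨⟨e0, he⟩, hel⟩ := ε
  obtain ⟨⟨c0, hc⟩, hcl⟩ := χ
  change X0 ⟶ W0 at e0
  change W0 ⟶ Z0 at c0
  have hfst : e0 ≫ c0 = f0 := congrArg (fun k => N0.homCarrier k) hfac
  haveI : IsIso ((PreFrobenioid.baseFunctor C0.toElem).map e0) := hε
  let ιW : (PreFrobenioid.baseFunctor C0.toElem).obj W0 ≅ π.obj XD :=
    (asIso ((PreFrobenioid.baseFunctor C0.toElem).map e0)).symm ≪≫ ιX
  let W : (towerN π).F := ⟨⟨⟨W0, XD, ιW⟩⟩⟩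
  have w₁ : (PreFrobenioid.baseFunctor C0.toElem).map e0 ≫ ιW.hom = ιX.hom ≫ π.map (𝟙 XD) := by
    simp [ιW]
  have w₂ : (PreFrobenioid.baseFunctor C0.toElem).map c0 ≫ ιZ.hom = ιW.hom ≫ π.map fD := by
    simp only [ιW, Iso.trans_hom, Iso.symm_hom, asIso_inv, Category.assoc]
    rw [← w, ← hfst, Functor.map_comp, Category.assoc, IsIso.inv_hom_id_assoc]
  have he1 : PreFrobenioid.Div C0.toElem e0 = 1 := he
  have hc1 : PreFrobenioid.Div C0.toElem c0 = 1 := hc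
  have p₁ : PreFrobenioid.isometricMorphisms (C.toElem π)
      (⟨e0, 𝟙 XD, w₁⟩ : (⟨X0, XD, ιX⟩ : C π) ⟶ ⟨W0, XD, ιW⟩) := by
    change pull _ _ (PreFrobenioid.Div C0.toElem e0) = 1
    rw [he1, map_one]
  have p₂ : PreFrobenioid.isometricMorphisms (C.toElem π)
      (⟨c0, fD, w₂⟩ : (⟨W0, XD, ιW⟩ : C π) ⟶ ⟨Z0, ZD, ιZ⟩) := by
    change pull _ _ (PreFrobenioid.Div C0.toElem c0) = 1
    rw [hc1, map_one]
  have l₁ : PreFrobenioid.linearMorphisms (A.toElem π)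
      (⟨⟨e0, 𝟙 XD, w₁⟩, p₁⟩ : (⟨⟨X0, XD, ιX⟩⟩ : A π) ⟶ ⟨⟨W0, XD, ιW⟩⟩) := hel
  have l₂ : PreFrobenioid.linearMorphisms (A.toElem π)
      (⟨⟨c0, fD, w₂⟩, p₂⟩ : (⟨⟨W0, XD, ιW⟩⟩ : A π) ⟶ ⟨⟨Z0, ZD, ιZ⟩⟩) := hcl
  refine ⟨W, ⟨⟨⟨e0, 𝟙 XD, w₁⟩, p₁⟩, l₁⟩, ⟨⟨⟨c0, fD, w₂⟩, p₂⟩, l₂⟩, Iso.refl _,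
    WideSubcategory.hom_ext _ (WideSubcategory.hom_ext _ (CFP.hom_ext hfst (Category.id_comp _))),
    ?_, ?_, ?_⟩
  · change IsIso (𝟙 XD)
    infer_instance
  · exact Category.comp_id _
  · exact Category.id_comp _

/-! ### The tower `towerN`: (Fac) -/

/-- (Fac) for `N`: every arrow `φ` of `N` factors as `φ = β ≫ α` with `β = (β₀, 𝟙)` over an identity
of `D` and `α` with pull-back `C₀`-component `(Base φ₀, 1, 1)` out of the object carrying the
pulled-back region; `β₀ = (𝟙, 1, c)` is linear since `φ` is. [cite: MochizukiFrdII2008, Prop 3.4 (viii) p.33] -/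
theorem N.exists_fac_pullback {X Y : (towerN π).F} (φ : X ⟶ Y) :
    ∃ (Z : (towerN π).F) (β : X ⟶ Z) (α : Z ⟶ Y), β ≫ α = φ ∧ IsIso ((towerN π).toD.map β) ∧
      PreFrobenioid.IsPullbackMorphism C0.toElem α.hom.hom.fst := by
  obtain ⟨⟨⟨X0, XD, ιX⟩⟩⟩ := X
  obtain ⟨⟨⟨Y0, YD, ιY⟩⟩⟩ := Y
  obtain ⟨⟨⟨f0, fD, w⟩, hf⟩, hfl⟩ := φ
  change X0 ⟶ Y0 at f0
  change XD ⟶ YD at fD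
  have hfl' : C0.degFr f0 = 1 := hfl
  obtain ⟨Ap, hA, b0, a0, hcomp, hbβ, hbα, hdβ, -, hdivβ, hdα, hsα, hisoα, hcar⟩ :=
    C0.exists_factor_pullRegion f0 (𝟙 X0.base) (C0.Base f0) (Category.id_comp _)
  have hpb : PreFrobenioid.IsPullbackMorphism C0.toElem a0 :=
    C0.isPullbackMorphism_of_region_eq a0 hdα hsα (by rw [hbα]; exact hcar)
  let Z : (towerN π).F := ⟨⟨⟨C0.mk X0.base Ap hA, XD, ιX⟩⟩⟩
  have wβ : (PreFrobenioid.baseFunctor C0.toElem).map b0 ≫ ιX.hom = ιX.hom ≫ π.map (𝟙 XD) := by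
    change C0.Base b0 ≫ ιX.hom = ιX.hom ≫ π.map (𝟙 XD)
    rw [hbβ, CategoryTheory.Functor.map_id, Category.id_comp, Category.comp_id]
  have wα : (PreFrobenioid.baseFunctor C0.toElem).map a0 ≫ ιY.hom = ιX.hom ≫ π.map fD := by
    change C0.Base a0 ≫ ιY.hom = ιX.hom ≫ π.map fD
    rw [hbα]
    exact w
  have hdivβ' : PreFrobenioid.Div C0.toElem b0 = PreFrobenioid.Div C0.toElem f0 := hdivβ
  have hdivα' : PreFrobenioid.Div C0.toElem a0 = 1 := hisoα
  have pβ : PreFrobenioid.isometricMorphisms (C.toElem π)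
      (⟨b0, 𝟙 XD, wβ⟩ : (⟨X0, XD, ιX⟩ : C π) ⟶ ⟨C0.mk X0.base Ap hA, XD, ιX⟩) := by
    change pull _ _ (PreFrobenioid.Div C0.toElem b0) = 1
    rw [hdivβ']
    exact hf
  have pα : PreFrobenioid.isometricMorphisms (C.toElem π)
      (⟨a0, fD, wα⟩ : (⟨C0.mk X0.base Ap hA, XD, ιX⟩ : C π) ⟶ ⟨Y0, YD, ιY⟩) := by
    change pull _ _ (PreFrobenioid.Div C0.toElem a0) = 1
    rw [hdivα', map_one]
  have lβ : PreFrobenioid.linearMorphisms (A.toElem π)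
      (⟨⟨b0, 𝟙 XD, wβ⟩, pβ⟩ : (⟨⟨X0, XD, ιX⟩⟩ : A π) ⟶ ⟨⟨C0.mk X0.base Ap hA, XD, ιX⟩⟩) := by
    change C0.degFr b0 = 1
    rw [hdβ, hfl']
  have lα : PreFrobenioid.linearMorphisms (A.toElem π)
      (⟨⟨a0, fD, wα⟩, pα⟩ : (⟨⟨C0.mk X0.base Ap hA, XD, ιX⟩⟩ : A π) ⟶ ⟨⟨Y0, YD, ιY⟩⟩) := hdα
  refine ⟨Z, ⟨⟨⟨b0, 𝟙 XD, wβ⟩, pβ⟩, lβ⟩, ⟨⟨⟨a0, fD, wα⟩, pα⟩, lα⟩,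
    WideSubcategory.hom_ext _ (WideSubcategory.hom_ext _ (CFP.hom_ext hcomp (Category.id_comp _))),
    ?_, hpb⟩
  change IsIso (𝟙 XD)
  infer_instance

/-! ### The tower `towerN`: (LiftD), item (vi) refined -/

/-- (LiftD) for `N` — item (vi) refined: if the `C₀`-component of `α : Z → Y` is a pull-back morphism
of `C₀` and `α_D = δ ≫ χ` in `D`, then `α = α₁ ≫ α₂` in `N` with `α₁`, `α₂` lifting `δ`, `χ` and with
pull-back `C₀`-components (t6's construction of `N.propVI` through the object carrying the
pulled-back region; both members are linear). [cite: MochizukiFrdII2008, Prop 3.4 (vi) p.30] -/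
theorem N.exists_factor_pullback {Z Y : (towerN π).F} (α : Z ⟶ Y)
    (hP : PreFrobenioid.IsPullbackMorphism C0.toElem α.hom.hom.fst)
    {E : D} (δ : (towerN π).toD.obj Z ⟶ E) (χ : E ⟶ (towerN π).toD.obj Y)
    (hfac : δ ≫ χ = (towerN π).toD.map α) :
    ∃ (Z' : (towerN π).F) (α₁ : Z ⟶ Z') (α₂ : Z' ⟶ Y) (i : (towerN π).toD.obj Z' ≅ E),
      α₁ ≫ α₂ = α ∧ (towerN π).toD.map α₁ ≫ i.hom = δ ∧ i.inv ≫ (towerN π).toD.map α₂ = χ ∧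
        PreFrobenioid.IsPullbackMorphism C0.toElem α₁.hom.hom.fst ∧
        PreFrobenioid.IsPullbackMorphism C0.toElem α₂.hom.hom.fst := by
  obtain ⟨⟨⟨Z0, ZD, ιZ⟩⟩⟩ := Z
  obtain ⟨⟨⟨Y0, YD, ιY⟩⟩⟩ := Y
  obtain ⟨⟨⟨a0, aD, w⟩, ha⟩, hal⟩ := α
  change Z0 ⟶ Y0 at a0
  change ZD ⟶ YD at aD
  change ZD ⟶ E at δ
  change E ⟶ YD at χ
  change δ ≫ χ = aD at hfac
  change PreFrobenioid.IsPullbackMorphism C0.toElem a0 at hP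
  have w'' : (PreFrobenioid.baseFunctor C0.toElem).map a0 = (ιZ.hom ≫ π.map aD) ≫ ιY.inv :=
    (Iso.eq_comp_inv ιY).mpr w
  have hb : (ιZ.hom ≫ π.map δ) ≫ (π.map χ ≫ ιY.inv) = C0.Base a0 :=
    calc (ιZ.hom ≫ π.map δ) ≫ (π.map χ ≫ ιY.inv)
        = (ιZ.hom ≫ π.map (δ ≫ χ)) ≫ ιY.inv := by simp only [Functor.map_comp, Category.assoc]
      _ = (ιZ.hom ≫ π.map aD) ≫ ιY.inv := by rw [hfac]
      _ = (PreFrobenioid.baseFunctor C0.toElem).map a0 := w''.symm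
  obtain ⟨Am, hA, b0, c0, hcomp, hbβ, hbα, hdβ, -, hdivβ, hdα, hsα, hisoα, hcar⟩ :=
    C0.exists_factor_pullRegion a0 (ιZ.hom ≫ π.map δ) (π.map χ ≫ ιY.inv) hb
  obtain ⟨hd_a0, hfull⟩ := (C0.isPullbackMorphism_iff a0).1 hP
  have hcar' : (C0.mk (π.obj E) Am hA).region.carrier = C0.pullRegion Y0 (C0.Base c0) := by
    rw [hbα]; exact hcar
  have hpb₂ : PreFrobenioid.IsPullbackMorphism C0.toElem c0 :=
    C0.isPullbackMorphism_of_region_eq c0 hdα hsα hcar'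
  have hpb₁ : PreFrobenioid.IsPullbackMorphism C0.toElem b0 :=
    C0.isPullbackMorphism_left_of_region_eq b0 c0 (hdβ.trans hd_a0) hdα hsα hcar'
      (by rw [hcomp]; exact hfull)
  let E0 : C0 := ⟨π.obj E, Am, hA⟩
  let E' : C π := ⟨E0, E, Iso.refl _⟩
  have hbβ' : (PreFrobenioid.baseFunctor C0.toElem).map b0 = ιZ.hom ≫ π.map δ := hbβ
  have hbα' : (PreFrobenioid.baseFunctor C0.toElem).map c0 = π.map χ ≫ ιY.inv := hbα
  have wβ : (PreFrobenioid.baseFunctor C0.toElem).map b0 ≫ E'.iso.hom = ιZ.hom ≫ π.map δ :=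
    (Category.comp_id _).trans hbβ'
  have wα : (PreFrobenioid.baseFunctor C0.toElem).map c0 ≫ ιY.hom = E'.iso.hom ≫ π.map χ :=
    ((Iso.eq_comp_inv ιY).mp hbα').trans (Category.id_comp _).symm
  have hdivβ' : PreFrobenioid.Div C0.toElem b0 = PreFrobenioid.Div C0.toElem a0 := hdivβ
  have hdivα' : PreFrobenioid.Div C0.toElem c0 = 1 := hisoα
  have pβ : PreFrobenioid.isometricMorphisms (C.toElem π)
      (⟨b0, δ, wβ⟩ : (⟨Z0, ZD, ιZ⟩ : C π) ⟶ E') := by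
    change pull _ _ (PreFrobenioid.Div C0.toElem b0) = 1
    rw [hdivβ']
    exact ha
  have pα : PreFrobenioid.isometricMorphisms (C.toElem π) (⟨c0, χ, wα⟩ : E' ⟶ ⟨Y0, YD, ιY⟩) := by
    change pull _ _ (PreFrobenioid.Div C0.toElem c0) = 1
    rw [hdivα', map_one]
  have lβ : PreFrobenioid.linearMorphisms (A.toElem π)
      (⟨⟨b0, δ, wβ⟩, pβ⟩ : (⟨⟨Z0, ZD, ιZ⟩⟩ : A π) ⟶ ⟨E'⟩) := by
    change C0.degFr b0 = 1
    rw [hdβ, hd_a0]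
  have lα : PreFrobenioid.linearMorphisms (A.toElem π) (⟨⟨c0, χ, wα⟩, pα⟩ : (⟨E'⟩ : A π) ⟶ ⟨⟨Y0, YD, ιY⟩⟩) :=
    hdα
  refine ⟨⟨⟨E'⟩⟩, ⟨⟨⟨b0, δ, wβ⟩, pβ⟩, lβ⟩, ⟨⟨⟨c0, χ, wα⟩, pα⟩, lα⟩, Iso.refl E,
    WideSubcategory.hom_ext _ (WideSubcategory.hom_ext _ (CFP.hom_ext hcomp hfac)),
    Category.comp_id _, Category.id_comp _, hpb₁, hpb₂⟩

end ArchFrd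

end

end Literature.AlgebraicGeometry.Frobenioids
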